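import Mathlib
import HarnessLib
import Literature.MathematicalPhysics.KineticTheory.VelocityFlipNoise
import Summits.AtomisticToContinuum.FouriersLaw.Theorems.VanishingNoiseTransferNoisyFourierFlipCeilingBondResponse
import Summits.AtomisticToContinuum.FouriersLaw.Theorems.VanishingNoiseTransferVanishingNoiseBoundStubForwardFieldLeakFreeAux1

/-!
# The leak of a flip forward field is invisible in interior windows
(stub `stub_forwardFieldLeakFree`, S2 of line `energy-dipole-leak-coercivity`, crux
stmt-AtomisticToContinuum-11976 `VanishingNoiseTransfer.VanishingNoiseBound`; `--supports` file)

Setting: the pinned anharmonic chain `P = pinnedChain ω₂ lam β γ` (all parameters `> 0`), `T > 0`,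
`L ≥ 2`, any flip rate `ε`, the Gibbs state `μ_T = P.gibbsMeasure L T`, and a classical dual FORWARD FIELD
`g ∈ C²`, `|g| ≤ C₀ e^{H/4T}`, of the flip-noisy equilibrium generator: `(L_{T,T} + εS) g = −(p_0² − T)`
pointwise (`S = flipNoise`, Bernardin–Olla's velocity flips). A WINDOW is a site interval
`[lo, hi] ⊆ [1, L−2]` (no bath site). For every smooth test function `φ` that depends only on the
coordinates `(q_k, p_k)`, `lo ≤ k ≤ hi`, vanishes as soon as one of those coordinates is `≥ R` in absolute
value, and is EVEN in every momentum:

  `∫ g · X_H φ dμ_T = 0`     (`forwardField_leakFree`, `stub_forwardFieldLeakFree`).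

Proof (an identity; Bernardin–Olla 2011 §2.1: `S` symmetric, `X_H` antisymmetric, `B` symmetric under
`μ_T`). `(g, k_0 + εSg)` is a forward pair of the plain equilibrium generator (`flip_forwardPair`,
`k_0 = p_0² − T`), and `φ` is a BACKWARD pair with source `X_H φ`: `−X_H φ + γ S_B φ = −X_H φ` because the
thermostats do not see `φ` (`S_B φ = 0`: `B = bathWeight` lives on the bath sites `0, L−1 ∉ [lo, hi]` and
`∂_{p_0} φ = ∂_{p_{L−1}} φ = 0`). The cutoff-free cross Green identity `integral_cross_eq` gives
`∫ g X_H φ dμ_T = ∫ φ (k_0 + εSg) dμ_T`, and both terms vanish: `⟨φ, Sg⟩ = ⟨Sφ, g⟩ = 0` (`S` symmetric,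
`Sφ = 0` for momentum-even `φ`) and `⟨φ, p_0² − T⟩_{μ_T} = 0` (`φ` does not depend on `p_0`, Gaussian
integration by parts). The `L²(μ_T)` regularity fed to `integral_cross_eq`: `g ∈ L²` from the `e^{H/4T}`
bound; `φ` and its first partials are BOUNDED (they are window-local and vanish far out in the window
coordinates, so they factor through a compact set), whence `|X_H φ| ≤ C(1 + H)` — this is the package
`memLp_two_of_windowLocal` of the companion file `…StubForwardFieldLeakFreeAux1` (`--supports` file 1/2;
this is file 2/2).

References: Bernardin–Olla 2011 §2.1; Bonetto–Lebowitz–Rey-Bellet 2000 §5.2; folklore.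
-/

noncomputable section

open MeasureTheory Filter Topology Finset
open scoped ContDiff
open Literature.MathematicalPhysics.KineticTheory.HeatConduction
open Summit.AtomisticToContinuum.FouriersLaw.Theorems.SuperadditiveResistance.DeviceLiouville
  (kin liouvilleOp bathOp kin_eq_sq)
open Summit.AtomisticToContinuum.FouriersLaw.Cruxes.SuperadditiveResistance.FloatingProbeBypassLaplacian
  (pinnedChain_memLp_two_snd_sq integral_mul_sq_sub_gibbsMeasure_eq_zero)
open Summit.AtomisticToContinuum.FouriersLaw.Cruxes.ConductanceLowerBound.ForecastSensitivity
  (integral_cross_eq)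
open Summit.AtomisticToContinuum.FouriersLaw.Cruxes.SuperadditiveResistance.InsertionToolbox
  (pinnedChain_memLp_two_of_abs_le)

namespace Summit.AtomisticToContinuum.FouriersLaw.Theorems.VanishingNoiseBound

/-! ## The leak of a flip forward field vanishes on interior windows -/

section LeakFree

variable {ω₂ lam β γ : ℝ}

/-- **The forward field's leak is invisible in interior windows.** For the pinned chain (all
parameters `> 0`), `T > 0`, `L ≥ 2`, any `ε`, every classical `C²`, `e^{H/4T}`-bounded solution `g` of
`(L_{T,T} + εS) g = −(p_0² − T)`, every window `[lo, hi] ⊆ [1, L−2]` and every smooth `φ` that depends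
only on the window coordinates, vanishes as soon as one of them is `≥ R` in size, and is even in every
momentum: `∫ g · X_H φ dμ_T = 0`. Proof: cross Green identity `integral_cross_eq` for the forward pair
`(g, k_0 + εSg)` against the backward pair `(φ, X_H φ)` (`S_B φ = 0`), then `⟨φ, Sg⟩ = ⟨Sφ, g⟩ = 0` and
`⟨φ, p_0² − T⟩_{μ_T} = 0`. [Bernardin–Olla 2011, §2.1] [folklore] -/
theorem forwardField_leakFree (hω : 0 < ω₂) (hl : 0 < lam) (hβ : 0 < β) (hγ : 0 < γ) {T : ℝ}
    (hT : 0 < T) (ε : ℝ) {L : ℕ} (hL : 2 ≤ L) {g : PhaseSpace L → ℝ} (hg2 : ContDiff ℝ 2 g)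
    (hgb : ∃ C₀ : ℝ, ∀ u, |g u| ≤ C₀ * Real.exp (1 / (4 * T) * (pinnedChain ω₂ lam β γ).hamiltonian L u))
    (hpde : ∀ u, (pinnedChain ω₂ lam β γ).flipGenerator L T T ε g u = -(kin L 0 u - T))
    {lo hi : ℕ} (hlo : 1 ≤ lo) (hhi : hi + 2 ≤ L) {φ : PhaseSpace L → ℝ} (hφ : ContDiff ℝ ∞ φ)
    (hdep : ∀ u v : PhaseSpace L,
      (∀ k : Fin L, lo ≤ k.val → k.val ≤ hi → u.1 k = v.1 k ∧ u.2 k = v.2 k) → φ u = φ v)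
    (hvan : ∃ R : ℝ, ∀ u : PhaseSpace L,
      (∃ k : Fin L, lo ≤ k.val ∧ k.val ≤ hi ∧ (R ≤ |u.1 k| ∨ R ≤ |u.2 k|)) → φ u = 0)
    (heven : ∀ (z : Fin L) (u : PhaseSpace L), φ (momentumFlip z u) = φ u) :
    ∫ u, g u * liouvilleOp (pinnedChain ω₂ lam β γ) L φ u ∂((pinnedChain ω₂ lam β γ).gibbsMeasure L T) =
      0 := by
  have hL0 : 0 < L := by omega
  set P := pinnedChain ω₂ lam β γ with hP
  set μ := P.gibbsMeasure L T with hμdef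
  set B := OscillatorChain.bathWeight L with hB
  haveI : IsProbabilityMeasure μ := pinnedChain_isProbabilityMeasure_gibbsMeasure hω hl.le hβ.le γ L hT
  have hflip := gibbs_flipInvariant (ω₂ := ω₂) (lam := lam) (β := β) (γ := γ) L T
  -- regularity of `g`
  obtain ⟨C₀, hC₀⟩ := hgb
  have h14 : 2 * (1 / (4 * T)) < 1 / T := by
    rw [show 2 * (1 / (4 * T)) = 1 / (2 * T) by field_simp; ring, div_lt_div_iff₀ (by positivity) hT]
    nlinarith
  have hgL : MemLp g 2 μ :=
    memLp_two_of_abs_le_exp_hamiltonian hω hl.le hβ.le γ L hT h14 hg2.continuous hC₀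
  -- regularity of `φ` and `X_H φ`
  have hφ2 : ContDiff ℝ 2 φ := hφ.of_le (by norm_cast)
  obtain ⟨hφL2, hXφL2⟩ := memLp_two_of_windowLocal hω hl.le hβ.le γ hT hφ2 hdep hvan
  -- the sources
  have hk0L2 : MemLp (fun x => kin L 0 x - T) 2 μ :=
    ((pinnedChain_memLp_two_snd_sq hω hl.le hβ.le γ L hT ⟨0, hL0⟩).sub (memLp_const T)).ae_eq
      (ae_of_all _ fun x => by simp [kin_eq_sq hL0])
  have hSgL2 : MemLp (flipNoise L g) 2 μ := memLp_flipNoise hflip hgL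
  set k' : PhaseSpace L → ℝ := fun x => (kin L 0 x - T) + ε * flipNoise L g x with hk'
  have hk'L2 : MemLp k' 2 μ := hk0L2.add (hSgL2.const_mul ε)
  -- the two pairs
  have hB0 : ∀ i, 0 ≤ B i := by
    intro i
    simp only [hB, OscillatorChain.bathWeight]
    positivity
  have hpg : ∀ x, 1 * liouvilleOp P L g x + γ * bathOp L B T g x = -k' x := fun x =>
    flip_forwardPair (ω₂ := ω₂) (lam := lam) (β := β) (γ := γ) L T ε (k := fun y => kin L 0 y - T) hpde x
  have hpφ : ∀ x, -1 * liouvilleOp P L φ x + γ * bathOp L B T φ x = -(liouvilleOp P L φ x) := by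
    intro x
    rw [hB, bathOp_bathWeight_eq_zero_of_window hdep hlo hhi T x]
    ring
  -- the cross identity, cutoff removed, in Gibbs-measure form
  have hρeq : ∫ x, φ x * k' x * P.gibbsDensity L T x =
      ∫ x, g x * liouvilleOp P L φ x * P.gibbsDensity L T x :=
    integral_cross_eq hω hl.le hβ.le L hT B hB0 1 hγ hg2 hφ2 hgL hk'L2 hφL2 hXφL2 hpg hpφ
  have hμeq : ∫ x, g x * liouvilleOp P L φ x ∂μ = ∫ x, φ x * k' x ∂μ := by
    rw [P.integral_gibbsMeasure, P.integral_gibbsMeasure, hρeq]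
  -- `⟨φ, k'⟩ = ⟨φ, k_0⟩ + ε⟨φ, Sg⟩ = 0 + 0`
  have hφk0 : ∫ x, φ x * (kin L 0 x - T) ∂μ = 0 := by
    have e1 : ∫ x, φ x * (kin L 0 x - T) ∂μ = ∫ x, φ x * (x.2 ⟨0, hL0⟩ ^ 2 - T) ∂μ :=
      integral_congr_ae (ae_of_all _ fun x => by dsimp only; rw [kin_eq_sq hL0])
    rw [e1]
    refine integral_mul_sq_sub_gibbsMeasure_eq_zero hω hl.le hβ.le γ L hT ⟨0, hL0⟩ (fun x t => ?_) hφL2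
    refine hdep _ _ fun k hk1 hk2 => ?_
    have hk0 : k ≠ ⟨0, hL0⟩ := fun h => by
      have h' : k.val = 0 := congrArg Fin.val h
      omega
    simp [hk0]
  have hφS : ∫ x, φ x * flipNoise L g x ∂μ = 0 := by
    have hgi : ∀ i, MemLp (fun x => g (momentumFlip i x)) 2 μ := memLp_comp_momentumFlip hflip hgL
    rw [integral_mul_flipNoise hflip (hφL2.integrable_mul hgL) (fun i => hφL2.integrable_mul (hgi i))]
    have h0 : flipNoise L φ = fun _ => 0 := funext fun x => flipNoise_eq_zero_of_invariant heven x
    simp [h0]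
  have hφk' : ∫ x, φ x * k' x ∂μ = 0 := by
    have i1 : Integrable (fun x => φ x * (kin L 0 x - T)) μ := hφL2.integrable_mul hk0L2
    have i2 : Integrable (fun x => φ x * flipNoise L g x) μ := hφL2.integrable_mul hSgL2
    have e : (fun x => φ x * k' x) = fun x => φ x * (kin L 0 x - T) + ε * (φ x * flipNoise L g x) := by
      funext x; rw [hk']; ring
    rw [e, integral_add i1 (i2.const_mul ε), integral_const_mul, hφS, hφk0]
    ring
  rw [hμeq, hφk']

end LeakFree

/-! ## The registered stub -/

/-- **Stub S2 · forwardFieldLeakFree** of line `energy-dipole-leak-coercivity` (crux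
stmt-AtomisticToContinuum-11976 `VanishingNoiseTransfer.VanishingNoiseBound`), in its registered form: for the
pinned chain (all parameters `> 0`), `T > 0`, `L ≥ 2`, any `ε`, every classical `C²`, `e^{H/4T}`-bounded dual
forward field `g` of the flip-noisy equilibrium generator (`(L_{T,T} + εS) g = −(p_0² − T)`), every interior
window `[lo, hi] ⊆ [1, L−2]` and every smooth window-local, far-vanishing, momentum-even `φ`:
`∫ g · X_H φ dμ_T = 0` (`forwardField_leakFree`). [Bernardin–Olla 2011, §2.1] [folklore] -/
theorem stub_forwardFieldLeakFree :
    ∀ ω₂ lam β γ : ℝ, 0 < ω₂ → 0 < lam → 0 < β → 0 < γ → ∀ (T ε : ℝ), 0 < T →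
      ∀ (L : ℕ), 2 ≤ L → ∀ g : PhaseSpace L → ℝ, ContDiff ℝ 2 g →
        (∃ C₀ : ℝ, ∀ u, |g u| ≤ C₀ * Real.exp (1 / (4 * T) * (pinnedChain ω₂ lam β γ).hamiltonian L u)) →
        (∀ u, (pinnedChain ω₂ lam β γ).flipGenerator L T T ε g u = -(kin L 0 u - T)) →
        ∀ (lo hi : ℕ), 1 ≤ lo → hi + 2 ≤ L →
        ∀ φ : PhaseSpace L → ℝ, ContDiff ℝ ((⊤ : ℕ∞) : WithTop ℕ∞) φ →
          (∀ u v : PhaseSpace L,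
            (∀ k : Fin L, lo ≤ k.val → k.val ≤ hi → u.1 k = v.1 k ∧ u.2 k = v.2 k) → φ u = φ v) →
          (∃ R : ℝ, ∀ u : PhaseSpace L,
            (∃ k : Fin L, lo ≤ k.val ∧ k.val ≤ hi ∧ (R ≤ |u.1 k| ∨ R ≤ |u.2 k|)) → φ u = 0) →
          (∀ (z : Fin L) (u : PhaseSpace L), φ (momentumFlip z u) = φ u) →
          ∫ u, g u * liouvilleOp (pinnedChain ω₂ lam β γ) L φ u
              ∂((pinnedChain ω₂ lam β γ).gibbsMeasure L T) = 0 :=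
  fun _ _ _ _ hω hl hβ hγ _ ε hT _ hL _ hg2 hgb hpde _ _ hlo hhi _ hφ hdep hvan heven =>
    forwardField_leakFree hω hl hβ hγ hT ε hL hg2 hgb hpde hlo hhi hφ hdep hvan heven

end Summit.AtomisticToContinuum.FouriersLaw.Theorems.VanishingNoiseBound

end
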